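import Literature.Geometry.Riemannian.BamlerGradientEstimate
import Literature.Geometry.Riemannian.RicciFlowCurvatureBlowupJunction
import HarnessLib

/-!
# `|∇u|²` is a subsolution of the heat equation along a Ricci flow (Bochner–Bernstein)

For a solution `u` of the heat equation `∂ₜu = Δ_{g(t)} u` coupled with a Ricci flow
`∂ₜg = −2 Ric` one has the classical identity

  `∂ₜ|∇u|² = Δ|∇u|² − 2|Hess u|² ≤ Δ|∇u|²`:

under the flow `∂ₜ|∇u|²_{g(t)} = 2Ric(∇u, ∇u) + 2⟨∇u̇, ∇u⟩`, and the Ricci term cancels against the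
Bochner formula `Δ|∇u|² = 2|Hess u|² + 2⟨∇u, ∇Δu⟩ + 2Ric(∇u, ∇u)` (Topping 2006, proof of
Prop. 8.2.6; Bamler 2020a, §4.2, proof of Thm. 4.1 "by Bochner's identity"). This is the pointwise
input of the Hein–Naber gradient bound `|∇P f|² ≤ P(|∇f|²)` for the heat semigroup of a Ricci flow
and of their `L²`-Poincaré inequality for conjugate heat kernel measures (Hein–Naber 2014,
Thm. 1.10; Bamler 2020a, §11).

Contents (everything proved; no definitions, no named facts):

* `MetricCoord.IsMetricFamilyOn.tDerivFun_gradSqAt_eq_of_heat`, `…_le_of_heat` — the identity and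
  the inequality in coordinates, for a coordinate Ricci flow `∂G/∂t = −2Ric(G)` and `v` solving
  `∂ₜv = Δ_{G t} v` on the coordinate patch (from `hasDerivWithinAt_gradSqAt_ricciFlow`,
  `CoordEntropyEvolution.lean`, and the Bochner formula `IsMetricOn.lapAt_gradSqAt`,
  `CoordBochner.lean`);
* `derivWithin_gradSq_le_of_heat_ricciFlow` — the inequality
  `∂ₜ|∇u|²_{g(t)}(x) ≤ Δ_{g(t)}|∇u|²(x)` on a manifold with boundaryless finite-dimensional model,
  for a Ricci flow of Riemannian metrics on `[s, t]`, `s < t`, and `u` `C^∞` on `M × [s, t]`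
  solving the heat equation (one-sided time derivatives at the end points), transported through
  the chart at `x` exactly as `IsRicciFlow.derivWithin_gradSq_PhiInv_le`
  (`BamlerGradientEstimate.lean`).

What is NOT here: the integrated consequences (`|∇P f|² ≤ P(|∇f|²)`, the Poincaré and
log-Sobolev inequalities for conjugate heat kernel measures), super Ricci flows `∂ₜg ≥ −2Ric`
(the tree's flow layer is the Ricci flow equation), and the variant for `|∇u|²/u`.

## References

* H.-J. Hein, A. Naber, *New logarithmic Sobolev inequalities and an ε-regularity theorem for the
  Ricci flow*, Comm. Pure Appl. Math. 67 (2014), 1543–1561, Thm. 1.10 and its proof.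
  [HeinNaber2014]
* R. H. Bamler, *Entropy and heat kernel bounds on a Ricci flow background*, arXiv:2008.07093
  (2020), §4.2 (proof of Thm. 4.1), §11. [Bamler2020Entropy]
* P. Topping, *Lectures on the Ricci flow*, LMS Lecture Note Series 325, CUP 2006, proof of
  Prop. 8.2.6 (Bochner formula under the flow). [Topping2006]
-/

noncomputable section

set_option maxSynthPendingDepth 3

open Set Filter Function
open scoped Topology ContDiff Manifold

/-! ## The coordinate computation: `∂ₜ|∇v|² = Δ|∇v|² − 2|Hess v|²` -/

namespace Literature.Geometry.Lorentzian

namespace MetricCoord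

namespace IsMetricFamilyOn

variable {E : Type*} [NormedAddCommGroup E] [NormedSpace ℝ E] [FiniteDimensional ℝ E]
  [CompleteSpace E] {G : ℝ → E → E →L[ℝ] E →L[ℝ] ℝ} {S : Set ℝ} {V : Set E} {x : E} {t : ℝ}
  {v : ℝ → E → ℝ}

variable (hG : IsMetricFamilyOn G S V)
  (hfl : ∀ s ∈ S, ∀ y ∈ V, tDeriv G S s y = (-2 : ℝ) • ricAt (G s) y)
include hG hfl

/-- **The evolution of `|∇v|²` for a heat solution along a coordinate Ricci flow** (Bochner–
Bernstein): let `G` be a smooth one-parameter family of metric components on `V × S` solving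
`∂G/∂t = −2 Ric(G)` and `v`, `C^∞` on `V × S`, solve at time `t` on `V` the heat equation
`∂ₜv = Δ_{G t} v`. Then at `x ∈ V`

  `∂ₜ |∇v|² = Δ |∇v|² − 2|Hess v|²`

(`∂ₜ|∇v|² = 2Ric(∇v,∇v) + 2 D(v̇)(♯Dv)` under the flow, `hasDerivWithinAt_gradSqAt_ricciFlow`, and
the Bochner formula `Δ|∇v|² = 2|Hess v|² + 2 D(Δv)(♯Dv) + 2Ric(∇v,∇v)`, `lapAt_gradSqAt`: the Ricci
terms cancel). [cite: Topping2006, proof of Prop. 8.2.6 (Bochner formula)]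
[cite: Bamler2020Entropy, §4.2, proof of Thm. 4.1] -/
theorem tDerivFun_gradSqAt_eq_of_heat
    (hv : ContDiffOn ℝ ∞ (fun p : E × ℝ ↦ v p.2 p.1) (V ×ˢ S)) (hx : x ∈ V) (ht : t ∈ S)
    (hveq : ∀ y ∈ V, tDerivFun v S t y = lapAt (G t) (v t) y) :
    tDerivFun (fun s y ↦ gradSqAt (G s) (v s) y) S t x =
      lapAt (G t) (gradSqAt (G t) (v t)) x - 2 * normSqAt (G t) x (hessAt (G t) (v t) x) := by
  have hGt := hG.isMetricOn t ht
  have hVo : IsOpen V := hG.isOpen ht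
  have hvt : ContDiffOn ℝ ∞ (v t) V := contDiffOn_of_family hv ht
  -- the time derivative of `|∇v|²` under the flow
  have hd := (hG.hasDerivWithinAt_gradSqAt_ricciFlow hfl hv hx ht).derivWithin
    (hG.uniqueDiffOn t ht)
  -- `D v̇ = D(Δ v)` at `x` (the equation holds on the neighbourhood `V` of `x`)
  have hweq : tDerivFun v S t =ᶠ[𝓝 x] lapAt (G t) (v t) := by
    filter_upwards [hVo.mem_nhds hx] with y hy using hveq y hy
  have hD : fderiv ℝ (tDerivFun v S t) x = fderiv ℝ (lapAt (G t) (v t)) x := hweq.fderiv_eq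
  -- the Bochner formula
  have hB := hGt.lapAt_gradSqAt hx hvt
  change derivWithin (fun s ↦ gradSqAt (G s) (v s) x) S t = _
  rw [hd, hD, hB]
  ring

/-- **`|∇v|²` is a subsolution of the heat equation along a coordinate Ricci flow**: under the
hypotheses of `tDerivFun_gradSqAt_eq_of_heat`, if `G t x` is positive definite then

  `∂ₜ |∇v|² ≤ Δ |∇v|²`

(drop `−2|Hess v|² ≤ 0`, `normSqAt_nonneg_of_posDef`).
[cite: Bamler2020Entropy, §4.2, proof of Thm. 4.1] [cite: HeinNaber2014, proof of Thm. 1.10] -/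
theorem tDerivFun_gradSqAt_le_of_heat
    (hv : ContDiffOn ℝ ∞ (fun p : E × ℝ ↦ v p.2 p.1) (V ×ˢ S)) (hx : x ∈ V) (ht : t ∈ S)
    (hveq : ∀ y ∈ V, tDerivFun v S t y = lapAt (G t) (v t) y)
    (hposdef : ∀ e : E, e ≠ 0 → 0 < G t x e e) :
    tDerivFun (fun s y ↦ gradSqAt (G s) (v s) y) S t x ≤ lapAt (G t) (gradSqAt (G t) (v t)) x := by
  rw [hG.tDerivFun_gradSqAt_eq_of_heat hfl hv hx ht hveq]
  have hn := normSqAt_nonneg_of_posDef ((hG.isMetricOn t ht).symm x hx) hposdef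
    (hessAt (G t) (v t) x)
  linarith

end IsMetricFamilyOn

end MetricCoord

end Literature.Geometry.Lorentzian

/-! ## The inequality `∂ₜ|∇u|² ≤ Δ|∇u|²` on the manifold -/

namespace Literature.Geometry.Riemannian

open Lorentzian Lorentzian.PseudoRiemannianMetric

variable {E : Type*} [NormedAddCommGroup E] [NormedSpace ℝ E] [FiniteDimensional ℝ E]
  [CompleteSpace E] {H : Type*} [TopologicalSpace H] {I : ModelWithCorners ℝ E H} [I.Boundaryless]
  {M : Type*} [TopologicalSpace M] [ChartedSpace H M] [IsManifold I ∞ M]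
  {g : ℝ → PseudoRiemannianMetric I ∞ E (TangentSpace I : M → Type _)}
  {cov : ℝ → CovariantDerivative I E (TangentSpace I : M → Type _)}

/-- **`|∇u|²` is a subsolution of the heat equation along a Ricci flow** (Bochner–Bernstein;
Hein–Naber 2014, proof of Thm. 1.10; Bamler 2020a, §4.2 "by Bochner's identity"). Let `(g, cov)`
be a Ricci flow of Riemannian metrics on `[s, t]`, `s < t`, on a manifold with boundaryless
finite-dimensional model (no compactness needed), and `u` a solution of the heat equation
`∂ₜu = Δ_{g(r)} u`, `C^∞` on `M × [s, t]` (one-sided time derivatives at the end points). Then at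
every `(x, r) ∈ M × [s, t]`

  `∂ₜ |∇u|²_{g(r)} (x) ≤ Δ_{g(r)} |∇u|²_{g(r)} (x)`

(indeed `∂ₜ|∇u|² = Δ|∇u|² − 2|Hess u|²`: read the flow and `u` in the chart at `x` —
`IsRicciFlow.isMetricFamilyOn_chartRep_Icc`, `tDeriv_chartRep_eq_Icc`, `lapAt_chartRep_eq`,
`gradSqAt_chartRep_eq` — and apply `MetricCoord.IsMetricFamilyOn.tDerivFun_gradSqAt_le_of_heat`).
[cite: HeinNaber2014, proof of Thm. 1.10] [cite: Bamler2020Entropy, §4.2, proof of Thm. 4.1]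
[cite: Topping2006, proof of Prop. 8.2.6] -/
theorem derivWithin_gradSq_le_of_heat_ricciFlow {s t : ℝ} (hst : s < t)
    (h : IsRicciFlow g cov (Icc s t)) (hR : ∀ r ∈ Icc s t, (g r).IsRiemannian)
    {u : ℝ → M → ℝ}
    (hu : ContMDiffOn (I.prod 𝓘(ℝ, ℝ)) 𝓘(ℝ, ℝ) ∞ (fun p : M × ℝ ↦ u p.2 p.1) (univ ×ˢ Icc s t))
    (hueq : ∀ r ∈ Icc s t, ∀ x : M,
      HasDerivWithinAt (fun r' ↦ u r' x) ((g r).laplaceBeltrami (u r) x) (Icc s t) r)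
    {r : ℝ} (hr : r ∈ Icc s t) (x : M) :
    derivWithin (fun r' ↦ (g r').gradSq (u r') x) (Icc s t) r ≤
      (g r).laplaceBeltrami ((g r).gradSq (u r)) x := by
  have h2 : (2 : ℕ∞ω) ≤ ∞ := WithTop.coe_le_coe.mpr le_top
  have hS : UniqueDiffOn ℝ (Icc s t) := uniqueDiffOn_Icc hst
  have hVopen : IsOpen (extChartAt I x).target := isOpen_extChartAt_target x
  -- (1) the flow read in the chart at `x`
  have hfam := h.isMetricFamilyOn_chartRep_Icc hst x
  have hfl : ∀ r' ∈ Icc s t, ∀ y ∈ (extChartAt I x).target,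
      MetricCoord.tDeriv (chartRep I g x) (Icc s t) r' y =
        (-2 : ℝ) • MetricCoord.ricAt (chartRep I g x r') y := fun r' hr' y hy ↦
    h.tDeriv_chartRep_eq_Icc hst x hr' hy
  -- (2) `u` read in the chart
  set uc : ℝ → E → ℝ := fun r' y ↦ u r' ((extChartAt I x).symm y)
  have huc_smooth : ContDiffOn ℝ ∞ (fun q : E × ℝ ↦ uc q.2 q.1)
      ((extChartAt I x).target ×ˢ Icc s t) :=
    contDiffOn_chart_of_contMDiffOn_source_prod (k := (⊤ : ℕ∞)) (w := u) x
      (hu.mono (prod_mono (subset_univ _) Subset.rfl))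
  have huslice : ∀ r' ∈ Icc s t, ContMDiff I 𝓘(ℝ, ℝ) ∞ (u r') := fun r' hr' ↦
    contMDiff_slice_of_contMDiffOn hu hr'
  have huct : ∀ r' ∈ Icc s t, ContDiffOn ℝ ∞ (uc r') (extChartAt I x).target := fun r' hr' ↦
    MetricCoord.contDiffOn_of_family huc_smooth hr'
  have huc2 : ∀ r' ∈ Icc s t, ∀ y : chartTarget I x, ContDiffAt ℝ 2 (uc r') y := fun r' hr' y ↦
    ((huct r' hr').contDiffAt (hVopen.mem_nhds y.2)).of_le h2
  have hurep : ∀ r', ∀ y : chartTarget I x, u r' (chartInv I x y) = uc r' y := fun r' y ↦ rfl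
  -- (3) the heat equation read in the chart, on `target × [s, t]`
  have hueqc : ∀ r' ∈ Icc s t, ∀ y ∈ (extChartAt I x).target,
      MetricCoord.tDerivFun uc (Icc s t) r' y =
        MetricCoord.lapAt (chartRep I g x r') (uc r') y := by
    intro r' hr' y hy
    have hΔ := lapAt_chartRep_eq g x r' ⟨y, hy⟩ (hurep r') (((huslice r' hr') _).of_le h2)
      (huc2 r' hr' ⟨y, hy⟩)
    rw [MetricCoord.tDerivFun, hΔ]
    exact (hueq r' hr' _).derivWithin (hS r' hr')
  -- (4) the coordinate inequality at `(φ x, r)`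
  have hy₀ : extChartAt I x x ∈ (extChartAt I x).target := mem_extChartAt_target x
  have hposdef : ∀ e : E, e ≠ 0 → 0 < chartRep I g x r (extChartAt I x x) e e := fun e he ↦
    chartRep_posDef g x r (hR r hr) ⟨_, hy₀⟩ e he
  have key := hfam.tDerivFun_gradSqAt_le_of_heat hfl (v := uc) huc_smooth hy₀ hr (hueqc r hr)
    hposdef
  -- (5) transport of each term back to `x`
  set u₀ : chartTarget I x := ⟨extChartAt I x x, hy₀⟩
  have hΦ0 : chartInv I x u₀ = x := extChartAt_to_inv x
  have hGt := hfam.isMetricOn r hr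
  -- (a) `|∇u_{r'}|²(x) = gradSqAt (G r') (uc r') (φ x)` for `r' ∈ [s, t]`
  have hgrad : ∀ r' ∈ Icc s t, (g r').gradSq (u r') x =
      MetricCoord.gradSqAt (chartRep I g x r') (uc r') (extChartAt I x x) := by
    intro r' hr'
    have h' := gradSqAt_chartRep_eq g x r' u₀ (hurep r')
      (((huslice r' hr') _).mdifferentiableAt (by simp))
      ((huc2 r' hr' u₀).differentiableAt two_ne_zero)
    rw [hΦ0] at h'
    exact h'.symm
  -- (b) the representative of `w_r = |∇u_r|²` on the chart target
  have hW : ContMDiffOn (I.prod 𝓘(ℝ, ℝ)) 𝓘(ℝ, ℝ) ∞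
      (fun p : M × ℝ ↦ (g p.2).gradSq (u p.2) p.1) (univ ×ˢ Icc s t) :=
    h.smooth.contMDiffOn_gradSq hS (f := u) hu
  have hWslice : ContMDiff I 𝓘(ℝ, ℝ) ∞ ((g r).gradSq (u r)) :=
    contMDiff_slice_of_contMDiffOn (u := fun r' y ↦ (g r').gradSq (u r') y) hW hr
  have hWrep : ∀ y : chartTarget I x, (g r).gradSq (u r) (chartInv I x y) =
      MetricCoord.gradSqAt (chartRep I g x r) (uc r) y := fun y ↦
    (gradSqAt_chartRep_eq g x r y (hurep r) (((huslice r hr) _).mdifferentiableAt (by simp))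
      ((huc2 r hr y).differentiableAt two_ne_zero)).symm
  have hWc : ContDiffOn ℝ ∞ (MetricCoord.gradSqAt (chartRep I g x r) (uc r))
      (extChartAt I x).target := hGt.contDiffOn_gradSqAt (huct r hr)
  -- (c) the time derivative
  have e1 : derivWithin (fun r' ↦ (g r').gradSq (u r') x) (Icc s t) r =
      MetricCoord.tDerivFun (fun r' z ↦ MetricCoord.gradSqAt (chartRep I g x r') (uc r') z)
        (Icc s t) r (extChartAt I x x) := by
    rw [MetricCoord.tDerivFun]
    exact derivWithin_congr (fun r' hr' ↦ hgrad r' hr') (hgrad r hr)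
  -- (d) the Laplacian of `w_r`
  have e2 : (g r).laplaceBeltrami ((g r).gradSq (u r)) x =
      MetricCoord.lapAt (chartRep I g x r)
        (MetricCoord.gradSqAt (chartRep I g x r) (uc r)) (extChartAt I x x) := by
    have h' := lapAt_chartRep_eq g x r u₀ hWrep
      (by rw [hΦ0]; exact (hWslice x).of_le h2)
      (MetricCoord.contDiffAt_two_of_contDiffOn hVopen hWc hy₀)
    rw [hΦ0] at h'
    exact h'.symm
  rw [e1, e2]
  exact key

end Literature.Geometry.Riemannian

end
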